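import Mathlib
import Summits.KontsevichZagierPeriods.Zeta5Search.WedgeDictionarySumRule
import Summits.KontsevichZagierPeriods.Zeta5Search.WedgeDictionaryTopPairDatum
import Summits.KontsevichZagierPeriods.Zeta5Search.WedgeDictionaryDiagonalDecomposition
import HarnessLib

/-!
# gen-1's wedge dictionary is ONE level-1 value; `I_init` is `I₀, I₁` (cell `pub-zeta5`, seat ct-1 g20)

HONEST FRAMING: systematic search; no irrationality claim unless certified.  OUR work (Summit side): kernel arithmetic of the
cell's dictionary at three level-1 points, the SUM RULE `WedgeDictionarySumRule.sumRule` (an elementary exact value), Brown–Zudilin's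
`Σ₇`-invariance (27) (tree theorem `InvarianceGroup.invariance_group_holds`) and modus ponens through ct-1 g18–g20's equivalences.
Nothing about `ζ(5)`; no linear form bounded; no denominator or exponent; records in print unmoved.

* §1 the dictionary at the axis point `(1,0,1,0,1,1,1,1)` (dual `(1;0⁷)`, partner 1: `(Q,P̂,P) = (−1,−7/6,−7/6)`, prediction
  `−θ + 14ζ(2)/3 + 7/3`), at the one-top point `(1,0,1,0,1,1,0,1)` (dual `(1;e₇)`, partner 1: `(1, 5/4, 3/4)`, prediction
  `θ − 5ζ(2) − 3/2`) and at the one-top point `(0,0,1,0,1,1,1,1)` (dual `(1;e₁)`, partner 2: the same prediction), from explicit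
  partial-fraction tables of `(2t+3)/((t+1)(t+2))^k`, `k = 4, 5, 6` (template `WedgeDictionaryInstances`); θ = 2ζ(5)+4ζ(3)ζ(2);
* §2 `cellularIntegral_one1_eq_one7` — the two one-top integrals are EQUAL (invariance (27) under the slot transposition `(1 7)`,
  all factorials `1`); the sum rule in defect form: `δ(axis) + δ(one-top) = 0`;
* §3 **`explicitPQ_iff_oneTop : explicitPQ ↔ ExplicitPQAt ![1,0,1,0,1,1,0,1] 1`**, `explicitPQ_iff_oneTop'` (the `(1;e₁)` point),
  **`explicitPQ_iff_axis`**, and **`explicitPQ_iff_diag1 : explicitPQ ↔ ExplicitPQAt ![1,1,1,1,1,1,1,1] 1`** — HYPOTHESIS-FREE: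
  gen-1's wedge dictionary (every admissible `a`, every partner) is EQUIVALENT to ONE number, e.g. to Brown–Zudilin's displayed
  `I₁ = 21θ − 101ζ(2) − 87/2`, or to `I(1,0,1,0,1,1,0,1) = θ − 5ζ(2) − 3/2`;
* §4 **`I_init_iff_zero_one : I_init ↔ (I₀ = θ ∧ I₁ = 21θ − 101ζ(2) − 87/2)`** — the printed `I₂` is REDUNDANT; with
  `WedgeDictionaryDiagonalDecomposition.I_solvesRec_of_I_init`, Brown–Zudilin's Sect. 2 (the table (5) AND the recursion) follows
  from `I₀` and `I₁` alone.

What this file is NOT: an evaluation of `I₁` or of `I(1,0,1,0,1,1,0,1)` (ONE genuine weight-5 period — the last analytic input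
between the tree and an unconditional `explicitPQ`; any weight-two evaluation only ever constrains `I(axis) + I(one-top)`), nor
anything about irrationality.  Theorems only (points, dual coordinates and tables are local notations).
-/

noncomputable section

open Finset Polynomial

namespace Summit.KontsevichZagierPeriods.Zeta5Search.WedgeDictionarySumRuleDatum

open Summit.KontsevichZagierPeriods.Zeta5Search.WedgeDictionary
open Summit.KontsevichZagierPeriods.Zeta5Search.WedgeDictionary.CertKit (defect defect_of_at at_of_defect)
open Summit.KontsevichZagierPeriods.Zeta5Search.DualSeries
open Summit.KontsevichZagierPeriods.Zeta5Search.WedgeDictionarySumRule (sumRule)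
open Summit.KontsevichZagierPeriods.Zeta5Search.WedgeDictionaryTopPairDatum (explicitPQAt_top17 explicitPQ_iff_data2
  explicitPQ_iff_diag2 explicitPQ_of_I_init coeff_bTop)
open Summit.KontsevichZagierPeriods.Zeta5Search.WedgeDictionaryDiagData (anchor1)
open Summit.KontsevichZagierPeriods.Zeta5Search.WedgeDictionaryDiagonalDecomposition (I_init_iff Isym_eq_of_explicitPQ)
open Summit.KontsevichZagierPeriods.Zeta5Search.CellStarPencilDischarge (explicitPQAt_slotPerm_iff)
open Summit.KontsevichZagierPeriods.Zeta5Search.InvarianceGroup (invariance_group_holds)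
open Literature.NumberTheory.Irrationality.BrownZudilin2022 (bOfA QOf cellularIntegral I_init Isym zeta5hat slotPerm
  normalisedIntegral' Qsol Phat P)
open Literature.NumberTheory.Transcendental (zetaValue)
open Literature.NumberTheory.Transcendental.BallRivoal (pfEval harm)

/-! ## 1. The dictionary at the three level-1 points -/

/-- The axis point `(1,0,1,0,1,1,1,1)`. -/
local notation "aAxis" => (![1, 0, 1, 0, 1, 1, 1, 1] : Fin 8 → ℤ)
/-- The one-top point `(1,0,1,0,1,1,0,1)` (dual slot `7`). -/
local notation "aOne7" => (![1, 0, 1, 0, 1, 1, 0, 1] : Fin 8 → ℤ)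
/-- The one-top point `(0,0,1,0,1,1,1,1)` (dual slot `1`). -/
local notation "aOne1" => (![0, 0, 1, 0, 1, 1, 1, 1] : Fin 8 → ℤ)

/-- `b(axis) = (1; 0⁷)`. -/
local notation "bAxis" => (fun j : ℕ => ite (j = 0) (1 : ℤ) 0)
/-- `(1; 1,0,0,0,0,0,0)` = the partner-1 shift of `b(axis)` = `b(0,0,1,0,1,1,1,1)`. -/
local notation "bE1" => (fun j : ℕ => ite (j = 0) (1 : ℤ) (ite (j = 1) 1 0))
/-- `b(1,0,1,0,1,1,0,1) = (1; 0,0,0,0,0,0,1)`. -/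
local notation "bE7" => (fun j : ℕ => ite (j = 0) (1 : ℤ) (ite (j = 7) 1 0))
/-- `(1; 1,0,0,0,0,0,1)` = the partner-1 shift of `bE7` (its PF table and `(U,W,V) = (0,−4,−5)` are the tree's
`WedgeDictionaryTopPairDatum.isPFData_bTop` / `coeff_bTop` — the same dual vector; not restated here, ct-1 g21). -/
local notation "bE17" => (fun j : ℕ => ite (j = 0) (1 : ℤ) (ite (j = 1) 1 (ite (j = 7) 1 0)))
/-- `(1; 1,1,0,0,0,0,0)` = the partner-2 shift of `bE1`. -/
local notation "bE12" => (fun j : ℕ => ite (j = 0) (1 : ℤ) (ite (j = 1) 1 (ite (j = 2) 1 0)))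

/-- Partial-fraction data of `(2t+3)/((t+1)(t+2))⁶`. -/
local notation "c6" => (fun o p : ℕ =>
  ite (o = 1 ∧ p = 0) (14 : ℚ) (ite (o = 1 ∧ p = 1) (-14) (ite (o = 2 ∧ p = 0) (-14) (ite (o = 2 ∧ p = 1) (-14)
  (ite (o = 3 ∧ p = 0) 9 (ite (o = 3 ∧ p = 1) (-9) (ite (o = 4 ∧ p = 0) (-4) (ite (o = 4 ∧ p = 1) (-4)
  (ite (o = 5 ∧ p = 0) 1 (ite (o = 5 ∧ p = 1) (-1) 0))))))))))

/-- Partial-fraction data of `(2t+3)/((t+1)(t+2))⁵`. -/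
local notation "c5" => (fun o p : ℕ =>
  ite (o = 1 ∧ p = 0) (-5 : ℚ) (ite (o = 1 ∧ p = 1) 5 (ite (o = 2 ∧ p = 0) 5 (ite (o = 2 ∧ p = 1) 5
  (ite (o = 3 ∧ p = 0) (-3) (ite (o = 3 ∧ p = 1) 3 (ite (o = 4 ∧ p = 0) 1 (ite (o = 4 ∧ p = 1) 1 0))))))))

/-- Partial-fraction data of `(2t+3)/((t+1)(t+2))⁴`. -/
local notation "c4" => (fun o p : ℕ =>
  ite (o = 1 ∧ p = 0) (2 : ℚ) (ite (o = 1 ∧ p = 1) (-2) (ite (o = 2 ∧ p = 0) (-2) (ite (o = 2 ∧ p = 1) (-2)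
    (ite (o = 3 ∧ p = 0) 1 (ite (o = 3 ∧ p = 1) (-1) 0))))))

/-- `b(1,0,1,0,1,1,1,1) = (1;0⁷)`. [folklore] -/
theorem bOfA_aAxis : bOfA aAxis = bAxis := by
  funext j; match j with
  | 0 => rfl | 1 => rfl | 2 => rfl | 3 => rfl | 4 => rfl | 5 => rfl | 6 => rfl | 7 => rfl | n + 8 => simp [bOfA]

/-- `b(1,0,1,0,1,1,0,1) = (1;e₇)`. [folklore] -/
theorem bOfA_aOne7 : bOfA aOne7 = bE7 := by
  funext j; match j with
  | 0 => rfl | 1 => rfl | 2 => rfl | 3 => rfl | 4 => rfl | 5 => rfl | 6 => rfl | 7 => rfl | n + 8 => simp [bOfA]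

/-- `b(0,0,1,0,1,1,1,1) = (1;e₁)`. [folklore] -/
theorem bOfA_aOne1 : bOfA aOne1 = bE1 := by
  funext j; match j with
  | 0 => rfl | 1 => rfl | 2 => rfl | 3 => rfl | 4 => rfl | 5 => rfl | 6 => rfl | 7 => rfl | n + 8 => simp [bOfA]

/-- Partner `1` at the axis point: `b + e₁ = (1;e₁)`. [folklore] -/
theorem update_bOfA_aAxis : Function.update (bOfA aAxis) 1 (bOfA aAxis 1 + 1) = bE1 := by
  rw [bOfA_aAxis]
  funext j; by_cases hj : j = 1
  · subst hj; simp
  · rw [Function.update_of_ne hj]; simp [hj]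

/-- Partner `1` at the `(1;e₇)` point: `b + e₁ = (1;1,0,0,0,0,0,1)`. [folklore] -/
theorem update_bOfA_aOne7 : Function.update (bOfA aOne7) 1 (bOfA aOne7 1 + 1) = bE17 := by
  rw [bOfA_aOne7]
  funext j; by_cases hj : j = 1
  · subst hj; simp
  · rw [Function.update_of_ne hj]; simp [hj]

/-- Partner `2` at the `(1;e₁)` point: `b + e₂ = (1;1,1,0,0,0,0,0)`. [folklore] -/
theorem update_bOfA_aOne1 : Function.update (bOfA aOne1) 2 (bOfA aOne1 2 + 1) = bE12 := by
  rw [bOfA_aOne1]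
  funext j; by_cases hj : j = 2
  · subst hj; simp
  · rw [Function.update_of_ne hj]; simp [hj]

/-- `numPoly` at `bAxis`: `(2X+1)(t+1) = 2t+3`. [folklore] -/
theorem eval_numPoly_bAxis (t : ℚ) :
    ((numPoly bAxis).comp (X + C 1)).eval t = (2 * t + 3) := by
  rw [eval_comp, eval_add, eval_X, eval_C, eval_numPoly]
  simp [Literature.NumberTheory.Transcendental.BallRivoal.poch]; ring

/-- `c6` is THE partial-fraction data of `R_{bAxis} = (2t+3)/((t+1)(t+2))^6`. [folklore] -/
theorem isPFData_bAxis : IsPFData bAxis c6 := by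
  intro t ht
  have hB : (bAxis 0).toNat = 1 := by decide
  rw [hB] at ht ⊢
  have h1 : t + 1 ≠ 0 := by have := ht 0 (by norm_num); simpa using this
  have h2 : t + 2 ≠ 0 := by have := ht 1 (by norm_num); intro h; apply this; push_cast; linarith
  rw [eval_numPoly_bAxis, poch_two]
  simp only [pfEval, sum_range_succ, sum_range_zero]
  norm_num; rw [show t + 1 + 1 = t + 2 by ring]
  field_simp; ring

/-- `numPoly` at `bE1`: `(2t+3)(t+1)(t+2)`. [folklore] -/
theorem eval_numPoly_bE1 (t : ℚ) :
    ((numPoly bE1).comp (X + C 1)).eval t = (2 * t + 3) * ((t + 1) * (t + 2)) := by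
  rw [eval_comp, eval_add, eval_X, eval_C, eval_numPoly]
  simp [prod_range_succ, Literature.NumberTheory.Transcendental.BallRivoal.poch]; ring

/-- `c5` is THE partial-fraction data of `R_{bE1} = (2t+3)/((t+1)(t+2))^5`. [folklore] -/
theorem isPFData_bE1 : IsPFData bE1 c5 := by
  intro t ht
  have hB : (bE1 0).toNat = 1 := by decide
  rw [hB] at ht ⊢
  have h1 : t + 1 ≠ 0 := by have := ht 0 (by norm_num); simpa using this
  have h2 : t + 2 ≠ 0 := by have := ht 1 (by norm_num); intro h; apply this; push_cast; linarith
  rw [eval_numPoly_bE1, poch_two]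
  simp only [pfEval, sum_range_succ, sum_range_zero]
  norm_num; rw [show t + 1 + 1 = t + 2 by ring]
  field_simp; ring

/-- `numPoly` at `bE7`: `(2t+3)(t+1)(t+2)`. [folklore] -/
theorem eval_numPoly_bE7 (t : ℚ) :
    ((numPoly bE7).comp (X + C 1)).eval t = (2 * t + 3) * ((t + 1) * (t + 2)) := by
  rw [eval_comp, eval_add, eval_X, eval_C, eval_numPoly]
  simp [prod_range_succ, Literature.NumberTheory.Transcendental.BallRivoal.poch]; ring

/-- `c5` is THE partial-fraction data of `R_{bE7} = (2t+3)/((t+1)(t+2))^5`. [folklore] -/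
theorem isPFData_bE7 : IsPFData bE7 c5 := by
  intro t ht
  have hB : (bE7 0).toNat = 1 := by decide
  rw [hB] at ht ⊢
  have h1 : t + 1 ≠ 0 := by have := ht 0 (by norm_num); simpa using this
  have h2 : t + 2 ≠ 0 := by have := ht 1 (by norm_num); intro h; apply this; push_cast; linarith
  rw [eval_numPoly_bE7, poch_two]
  simp only [pfEval, sum_range_succ, sum_range_zero]
  norm_num; rw [show t + 1 + 1 = t + 2 by ring]
  field_simp; ring

/-- `numPoly` at `bE12`: `(2t+3)((t+1)(t+2))²`. [folklore] -/
theorem eval_numPoly_bE12 (t : ℚ) :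
    ((numPoly bE12).comp (X + C 1)).eval t = (2 * t + 3) * ((t + 1) * (t + 2)) ^ 2 := by
  rw [eval_comp, eval_add, eval_X, eval_C, eval_numPoly]
  simp [prod_range_succ, Literature.NumberTheory.Transcendental.BallRivoal.poch]; ring

/-- `c4` is THE partial-fraction data of `R_{bE12} = (2t+3)/((t+1)(t+2))^4`. [folklore] -/
theorem isPFData_bE12 : IsPFData bE12 c4 := by
  intro t ht
  have hB : (bE12 0).toNat = 1 := by decide
  rw [hB] at ht ⊢
  have h1 : t + 1 ≠ 0 := by have := ht 0 (by norm_num); simpa using this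
  have h2 : t + 2 ≠ 0 := by have := ht 1 (by norm_num); intro h; apply this; push_cast; linarith
  rw [eval_numPoly_bE12, poch_two]
  simp only [pfEval, sum_range_succ, sum_range_zero]
  norm_num; rw [show t + 1 + 1 = t + 2 by ring]
  field_simp; ring

/-- `(U, W, V)(bAxis) = (-8, -28, -42)`. [folklore] -/
theorem coeff_bAxis : coeffU bAxis = -8 ∧ coeffW bAxis = -28 ∧ coeffV bAxis = -42 := by
  have hB : (bAxis 0).toNat = 1 := by decide
  refine ⟨?_, ?_, ?_⟩
  · rw [coeffU_eq isPFData_bAxis, hB]; simp only [sum_range_succ, sum_range_zero]; norm_num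
  · rw [coeffW_eq isPFData_bAxis, hB]; simp only [sum_range_succ, sum_range_zero]; norm_num
  · rw [coeffV_eq isPFData_bAxis, hB]; simp only [sum_range_succ, sum_range_zero, harm]; norm_num

/-- `(U, W, V)(bE1) = (2, 10, 14)`. [folklore] -/
theorem coeff_bE1 : coeffU bE1 = 2 ∧ coeffW bE1 = 10 ∧ coeffV bE1 = 14 := by
  have hB : (bE1 0).toNat = 1 := by decide
  refine ⟨?_, ?_, ?_⟩
  · rw [coeffU_eq isPFData_bE1, hB]; simp only [sum_range_succ, sum_range_zero]; norm_num
  · rw [coeffW_eq isPFData_bE1, hB]; simp only [sum_range_succ, sum_range_zero]; norm_num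
  · rw [coeffV_eq isPFData_bE1, hB]; simp only [sum_range_succ, sum_range_zero, harm]; norm_num

/-- `(U, W, V)(bE7) = (2, 10, 14)`. [folklore] -/
theorem coeff_bE7 : coeffU bE7 = 2 ∧ coeffW bE7 = 10 ∧ coeffV bE7 = 14 := by
  have hB : (bE7 0).toNat = 1 := by decide
  refine ⟨?_, ?_, ?_⟩
  · rw [coeffU_eq isPFData_bE7, hB]; simp only [sum_range_succ, sum_range_zero]; norm_num
  · rw [coeffW_eq isPFData_bE7, hB]; simp only [sum_range_succ, sum_range_zero]; norm_num
  · rw [coeffV_eq isPFData_bE7, hB]; simp only [sum_range_succ, sum_range_zero, harm]; norm_num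

/-- `(U, W, V)(bE12) = (0, -4, -5)`. [folklore] -/
theorem coeff_bE12 : coeffU bE12 = 0 ∧ coeffW bE12 = -4 ∧ coeffV bE12 = -5 := by
  have hB : (bE12 0).toNat = 1 := by decide
  refine ⟨?_, ?_, ?_⟩
  · rw [coeffU_eq isPFData_bE12, hB]; simp only [sum_range_succ, sum_range_zero]; norm_num
  · rw [coeffW_eq isPFData_bE12, hB]; simp only [sum_range_succ, sum_range_zero]; norm_num
  · rw [coeffV_eq isPFData_bE12, hB]; simp only [sum_range_succ, sum_range_zero, harm]; norm_num

/-- `Q(axis) = −1`. [folklore] -/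
theorem QOf_aAxis : QOf aAxis = -1 := by decide
/-- `Q(1,0,1,0,1,1,0,1) = 1`. [folklore] -/
theorem QOf_aOne7 : QOf aOne7 = 1 := by decide
/-- `Q(0,0,1,0,1,1,1,1) = 1`. [folklore] -/
theorem QOf_aOne1 : QOf aOne1 = 1 := by decide
/-- `ρ(axis) = 1/24`. [folklore] -/
theorem rhoOf_aAxis : rhoOf aAxis = 1 / 24 := by decide +kernel
/-- `ρ(1,0,1,0,1,1,0,1) = −1/8`. [folklore] -/
theorem rhoOf_aOne7 : rhoOf aOne7 = -1 / 8 := by decide +kernel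
/-- `ρ(0,0,1,0,1,1,1,1) = −1/8`. [folklore] -/
theorem rhoOf_aOne1 : rhoOf aOne1 = -1 / 8 := by decide +kernel

/-- `P̂_d(axis, 1) = −7/6`. [folklore] -/
theorem dictPhat_aAxis : dictPhat aAxis 1 = -7 / 6 := by
  unfold dictPhat
  rw [update_bOfA_aAxis, bOfA_aAxis, rhoOf_aAxis, coeff_bAxis.1, coeff_bE1.1, coeff_bAxis.2.2, coeff_bE1.2.2]
  norm_num

/-- `P_d(axis, 1) = −7/6`. [folklore] -/
theorem dictP_aAxis : dictP aAxis 1 = -7 / 6 := by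
  unfold dictP
  rw [update_bOfA_aAxis, bOfA_aAxis, rhoOf_aAxis, coeff_bAxis.2.1, coeff_bE1.2.1, coeff_bAxis.2.2, coeff_bE1.2.2]
  norm_num

/-- `P̂_d((1,0,1,0,1,1,0,1), 1) = 5/4`. [folklore] -/
theorem dictPhat_aOne7 : dictPhat aOne7 1 = 5 / 4 := by
  unfold dictPhat
  rw [update_bOfA_aOne7, bOfA_aOne7, rhoOf_aOne7, coeff_bE7.1, coeff_bTop.1, coeff_bE7.2.2, coeff_bTop.2.2]
  norm_num

/-- `P_d((1,0,1,0,1,1,0,1), 1) = 3/4`. [folklore] -/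
theorem dictP_aOne7 : dictP aOne7 1 = 3 / 4 := by
  unfold dictP
  rw [update_bOfA_aOne7, bOfA_aOne7, rhoOf_aOne7, coeff_bE7.2.1, coeff_bTop.2.1, coeff_bE7.2.2, coeff_bTop.2.2]
  norm_num

/-- `P̂_d((0,0,1,0,1,1,1,1), 2) = 5/4`. [folklore] -/
theorem dictPhat_aOne1 : dictPhat aOne1 2 = 5 / 4 := by
  unfold dictPhat
  rw [update_bOfA_aOne1, bOfA_aOne1, rhoOf_aOne1, coeff_bE1.1, coeff_bE12.1, coeff_bE1.2.2, coeff_bE12.2.2]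
  norm_num

/-- `P_d((0,0,1,0,1,1,1,1), 2) = 3/4`. [folklore] -/
theorem dictP_aOne1 : dictP aOne1 2 = 3 / 4 := by
  unfold dictP
  rw [update_bOfA_aOne1, bOfA_aOne1, rhoOf_aOne1, coeff_bE1.2.1, coeff_bE12.2.1, coeff_bE1.2.2, coeff_bE12.2.2]
  norm_num

/-! ## 2. The two one-top integrals are equal; the sum rule in defect form -/

/-- The slot transposition `(1 7)` carries the `(1;e₇)` point to the `(1;e₁)` point. [folklore] -/
theorem slotPerm_aOne7 : slotPerm (Equiv.swap (0 : Fin 7) 6) aOne7 = aOne1 := by decide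

/-- **`I(0,0,1,0,1,1,1,1) = I(1,0,1,0,1,1,0,1)`** — Brown–Zudilin's invariance (27) (`invariance_group_holds`) under the slot
transposition `(1 7)`; both factorial normalisations are `1`. [folklore] -/
theorem cellularIntegral_one1_eq_one7 : cellularIntegral aOne1 = cellularIntegral aOne7 := by
  have h := invariance_group_holds (Equiv.swap (0 : Fin 7) 6) aOne7 (by decide) (by rw [slotPerm_aOne7]; decide)
  rw [slotPerm_aOne7] at h
  unfold normalisedIntegral' at h
  rw [prodF_eq_cast, prodF_eq_cast, show prodFNat (bOfA aOne1) = 1 from by decide,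
    show prodFNat (bOfA aOne7) = 1 from by decide] at h
  simpa using h

/-- The defects at the two one-top points (partners `2` and `1`) coincide. [folklore] -/
theorem defect_one1_eq_one7 : defect aOne1 2 = defect aOne7 1 := by
  unfold defect
  rw [cellularIntegral_one1_eq_one7, QOf_aOne1, QOf_aOne7, dictPhat_aOne1, dictPhat_aOne7, dictP_aOne1, dictP_aOne7]

/-- **The sum rule in defect form**: `δ(axis, 1) + δ((1,0,1,0,1,1,0,1), 1) = 0` — the predictions add up to `5/6 − ζ(2)/3`,
which IS the sum of the integrals (`sumRule`). [folklore] -/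
theorem defect_axis_add_one7 : defect aAxis 1 + defect aOne7 1 = 0 := by
  unfold defect
  rw [QOf_aAxis, QOf_aOne7, dictPhat_aAxis, dictPhat_aOne7, dictP_aAxis, dictP_aOne7]
  have h := sumRule
  push_cast
  linear_combination h

/-! ## 3. The dictionary is ONE level-1 value -/

/-- `D1 ⟺ D2(e₇)`: given the sum rule, the axis value and the one-top value determine each other. [folklore] -/
theorem explicitPQAt_axis_iff_one7 : ExplicitPQAt aAxis 1 ↔ ExplicitPQAt aOne7 1 := by
  have h := defect_axis_add_one7
  constructor
  · intro hA
    have := defect_of_at hA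
    exact at_of_defect (by linarith)
  · intro hO
    have := defect_of_at hO
    exact at_of_defect (by linarith)

/-- `D2(e₁) ⟺ D2(e₇)` (one `Σ₇`-orbit: `explicitPQAt_slotPerm_iff`). [folklore] -/
theorem explicitPQAt_one1_iff_one7 : ExplicitPQAt aOne1 2 ↔ ExplicitPQAt aOne7 1 := by
  have h := explicitPQAt_slotPerm_iff (Equiv.swap (0 : Fin 7) 6) (a := aOne7) (j := 1) (j' := 2)
    (by unfold RegionHyp; decide) (by rw [slotPerm_aOne7]; unfold RegionHyp; decide)
  rw [slotPerm_aOne7] at h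
  exact h.symm

/-- **gen-1's wedge dictionary `explicitPQ` (every admissible `a`, every partner) ⟺ ONE level-1 value**: the dictionary identity
at the one-top point `(1,0,1,0,1,1,0,1)` with partner `1`, i.e. `I(1,0,1,0,1,1,0,1) = θ − 5ζ(2) − 3/2`.  HYPOTHESIS-FREE. [folklore] -/
theorem explicitPQ_iff_oneTop : explicitPQ ↔ ExplicitPQAt ![1, 0, 1, 0, 1, 1, 0, 1] 1 := by
  rw [explicitPQ_iff_data2]
  constructor
  · exact fun h => explicitPQAt_one1_iff_one7.1 h.2
  · exact fun h => ⟨explicitPQAt_axis_iff_one7.2 h, explicitPQAt_one1_iff_one7.2 h⟩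

/-- The same with the `(1;e₁)` representative `(0,0,1,0,1,1,1,1)`, partner `2`. [folklore] -/
theorem explicitPQ_iff_oneTop' : explicitPQ ↔ ExplicitPQAt ![0, 0, 1, 0, 1, 1, 1, 1] 2 := by
  rw [explicitPQ_iff_oneTop, explicitPQAt_one1_iff_one7]

/-- **`explicitPQ` ⟺ the AXIS value** `I(1,0,1,0,1,1,1,1) = −θ + 14ζ(2)/3 + 7/3`. [folklore] -/
theorem explicitPQ_iff_axis : explicitPQ ↔ ExplicitPQAt ![1, 0, 1, 0, 1, 1, 1, 1] 1 := by
  rw [explicitPQ_iff_oneTop, explicitPQAt_axis_iff_one7]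

/-- **`explicitPQ` ⟺ its SMALLEST DIAGONAL instance** `ExplicitPQAt 1⁸ 1`, i.e. ⟺ Brown–Zudilin's displayed
`I₁ = 21θ − 101ζ(2) − 87/2` read as the dictionary identity (gen-1 g17's anchoring row `n = 1`: `δ(1⁸) + 12δ₁ − 9δ₂ + 2δ₁₇ = 0`,
with `δ₁₇ = 0`, `δ₁ = −δ₂` from §2).  HYPOTHESIS-FREE. [folklore] -/
theorem explicitPQ_iff_diag1 : explicitPQ ↔ ExplicitPQAt ![1, 1, 1, 1, 1, 1, 1, 1] 1 := by
  refine ⟨fun h => (explicitPQ_iff_diag2.1 h).1, fun K1 => ?_⟩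
  have hrow := anchor1
  have e1 := defect_of_at K1
  have e17 := defect_of_at explicitPQAt_top17
  have hs := defect_axis_add_one7
  have ht := defect_one1_eq_one7
  rw [explicitPQ_iff_oneTop]
  exact at_of_defect (by linear_combination (-1 / 21 : ℝ) * hrow + (1 / 21 : ℝ) * e1 + (2 / 21 : ℝ) * e17 +
    (12 / 21 : ℝ) * hs - (9 / 21 : ℝ) * ht)

/-! ## 4. `I_init` is `I₀` and `I₁` -/

/-- **Brown–Zudilin's printed `I₂` is redundant**: `I_init ↔ (I₀ = θ ∧ I₁ = 21θ − 4·(101/4)ζ(2) − 2·(87/4))`. [folklore] -/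
theorem I_init_iff_zero_one :
    I_init ↔ (Isym 0 = zeta5hat ∧ Isym 1 = 21 * zeta5hat - 4 * (101 / 4 : ℝ) * zetaValue 2 - 2 * (87 / 4 : ℝ)) := by
  refine ⟨fun h => ⟨h.1, h.2.1⟩, fun h => ?_⟩
  have K1 : ExplicitPQAt ![1, 1, 1, 1, 1, 1, 1, 1] 1 := by
    rw [← aDiag_one]
    exact WedgeDictionaryDiagData.explicitPQAt_aDiag_of_eq (by rw [h.2]; simp [Qsol, Phat, P])
  exact I_init_iff.2 ⟨h.1, explicitPQ_iff_diag1.2 K1⟩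

end Summit.KontsevichZagierPeriods.Zeta5Search.WedgeDictionarySumRuleDatum

end
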